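import Mathlib
import Summits.ValiantsHypothesis.ValiantsHypothesis.Theses.BarrierLever
import Literature.Computability.AlgebraicComplexity.ArithCircuitProofs
import Literature.Computability.AlgebraicComplexity.RazUniversalCircuits
import Literature.Algebra.EuclideanLattices.RegevUSVPNumerics
import Summits.ValiantsHypothesis.ValiantsHypothesis.Theorems.BarrierLeverDefinableEquationsDefs
import Summits.ValiantsHypothesis.ValiantsHypothesis.Theorems.BarrierLeverDefinableEquationsStubRazTopUniversality

/-!
# Crux `BarrierLever.DefinableEquations` (stmt-ValiantsHypothesis-8745) — the unconditional floor:
# equations for `VP(n^b)` of polynomial degree and QUASI-polynomial size (lead c4)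

LEMMAS for `quasiPolyEquations` (registered sub-goal, file `…QuasiPolyEquations.lean`): for every size exponent `b` there are `k, n₀` such that
for all `n ≥ n₀` some NONZERO polynomial `E` in the `N = C(2n,n)` coefficient variables, of total
degree `≤ n^k = polylog(N)^{O(1)}` and fan-in-two size `≤ 2^(n^k) = quasipoly(N)`, vanishes at
`coeff(f)` for every `f ∈ SmallCircuits ℂ n b` (degree `≤ n`, size `≤ n^b`).  This is the folklore
dimension count (Heintz–Schnorr 1980; the starting point of Chatterjee–Tengse arXiv:2309.07612 §1.2)
made kernel-checked over the tree's objects: the crux asks for the same with size `N^a = 2^{O(an)}`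
and boolean sums, uniformly in `b`; unconditionally only this quasi-polynomial bound (or CT23's
VPSPACE-explicitness) is known, even for one fixed `b ≥ 2`.

Proof.  Raz's polynomial map `Γ` (tree `RazUniversal.uCoeff`, label-degree `≤ 2n - 1`,
`RazUniversal.totalDegree_uCoeff_le`) parametrises the top components of `SmallCircuits ℂ n b`
(landed stub A `stub_razTopUniversality`) by `m = #Lab ≤ 3 (2n + 4 n^b (n+1)² + 1)^5` labels
(`RazUniversal.card_lab_le`).  Take `D = m + 1` blocks of `K = 2nD + 2` distinct top monomials
(`exists_injective_topMonomials`: `2^(n-1)` of them are available) and the `K^D` square-free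
products of one variable per block: their pull-backs along `Γ` are `K^D` polynomials of degree
`≤ D (2n-1)` in `m` variables, a space of dimension `≤ (D(2n-1)+1)^m < K^D`, so a nontrivial
combination `E` pulls back to `0` (`exists_annihilator`, `LinearMap.ker_ne_bot_of_finrank_lt`);
`E ≠ 0` because distinct block-products are distinct monomials; `E` vanishes at every Raz point,
hence (stub A) at the top coefficients of every small circuit, and is transported to all
`degLEMonomials n` along `topIncl`.  Sizes: `deg E ≤ D`, `L(E) ≤ K^D (D + 2) ≤ 2^(n^k)`.

No new definitions, no named facts.
-/

set_option linter.dupNamespace false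

noncomputable section

namespace Summit.ValiantsHypothesis.ValiantsHypothesis.Theorems.BarrierLeverDefinableEquations

open MvPolynomial
open Literature.Computability.AlgebraicComplexity Literature.Barriers.ValiantsHypothesis
open scoped BigOperators

namespace QuasiPoly

/-! ## 1. The dimension count: a nontrivial combination of block-products pulling back to zero -/

/-- **Annihilator by dimension count.**  Let `u : T → ℂ[L]` be polynomials of degree `≤ δ` in
`m = #L` variables and `t : Fin D × Fin K → T` a block family.  If `(D δ + 1)^m < K^D` then some
nonzero coefficient vector `c` on the `K^D` block-products `∏_j u (t (j, g j))` combines them to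
`0`: the products lie in the space of polynomials of degree `≤ D δ`, whose coefficient functionals on
the `≤ (Dδ+1)^m` exponents of degree `≤ D δ` separate it. [folklore] -/
theorem exists_annihilator {L : Type*} [Fintype L] [DecidableEq L] {T : Type*}
    (u : T → MvPolynomial L ℂ) (δ : ℕ) (hu : ∀ t, (u t).totalDegree ≤ δ) (D K : ℕ)
    (t : Fin D × Fin K → T) (hcard : (D * δ + 1) ^ Fintype.card L < K ^ D) :
    ∃ c : (Fin D → Fin K) → ℂ, c ≠ 0 ∧ (∑ g, c g • ∏ j, u (t (j, g j))) = 0 := by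
  classical
  -- the exponents of degree `≤ D δ`
  set S' : Finset (L →₀ ℕ) :=
    (Finset.range (D * δ + 1)).biUnion fun d => (Finset.univ : Finset L).finsuppAntidiag d with hS'
  -- the combination map and its coefficients on `S'`
  let Ψ : ((Fin D → Fin K) → ℂ) →ₗ[ℂ] MvPolynomial L ℂ :=
    Fintype.linearCombination ℂ (fun g => ∏ j, u (t (j, g j)))
  let Φ : ((Fin D → Fin K) → ℂ) →ₗ[ℂ] (↥S' → ℂ) :=
    LinearMap.pi fun s => (MvPolynomial.lcoeff ℂ (s : L →₀ ℕ)).comp Ψ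
  -- `#S' ≤ (Dδ+1)^m`
  have hbound : ∀ s ∈ S', ∀ l, s l ≤ D * δ := by
    intro s hs l
    rw [hS', Finset.mem_biUnion] at hs
    obtain ⟨d, hd, hs⟩ := hs
    rw [Finset.mem_range] at hd
    rw [Finset.mem_finsuppAntidiag'] at hs
    obtain ⟨hsum, -⟩ := hs
    have h1 : s l ≤ s.sum (fun _ x => x) := by
      unfold Finsupp.sum
      by_cases hl : l ∈ s.support
      · exact Finset.single_le_sum (f := fun i => s i) (fun _ _ => Nat.zero_le _) hl
      · rw [Finsupp.notMem_support_iff.mp hl]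
        exact Nat.zero_le _
    omega
  have hS'card : Fintype.card ↥S' ≤ (D * δ + 1) ^ Fintype.card L := by
    let ι : ↥S' → (L → Fin (D * δ + 1)) :=
      fun s l => ⟨(s : L →₀ ℕ) l, Nat.lt_succ_of_le (hbound s s.2 l)⟩
    have hι : Function.Injective ι := by
      intro s₁ s₂ h
      apply Subtype.ext
      ext l
      have := congrFun h l
      simp only [ι, Fin.mk.injEq] at this
      exact this
    calc Fintype.card ↥S' ≤ Fintype.card (L → Fin (D * δ + 1)) :=
          Fintype.card_le_of_injective ι hι
      _ = (D * δ + 1) ^ Fintype.card L := by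
          rw [Fintype.card_fun, Fintype.card_fin]
  have hlt : Module.finrank ℂ (↥S' → ℂ) < Module.finrank ℂ ((Fin D → Fin K) → ℂ) := by
    rw [Module.finrank_fintype_fun_eq_card, Module.finrank_fintype_fun_eq_card]
    calc Fintype.card ↥S' ≤ (D * δ + 1) ^ Fintype.card L := hS'card
      _ < K ^ D := hcard
      _ = Fintype.card (Fin D → Fin K) := by rw [Fintype.card_fun, Fintype.card_fin, Fintype.card_fin]
  have hker := LinearMap.ker_ne_bot_of_finrank_lt (f := Φ) hlt
  obtain ⟨c, hcker, hc0⟩ := (Submodule.ne_bot_iff _).mp hker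
  refine ⟨c, hc0, ?_⟩
  have hΦ : Φ c = 0 := LinearMap.mem_ker.mp hcker
  have hΨ : Ψ c = ∑ g, c g • ∏ j, u (t (j, g j)) := Fintype.linearCombination_apply _ _ _
  -- degree bound of the combination
  have hdeg : (Ψ c).totalDegree ≤ D * δ := by
    rw [hΨ]
    refine MvPolynomial.totalDegree_finsetSum_le fun g _ => ?_
    refine (MvPolynomial.totalDegree_smul_le _ _).trans ?_
    refine (MvPolynomial.totalDegree_finsetProd _ _).trans ?_
    calc ∑ j, (u (t (j, g j))).totalDegree ≤ ∑ _j : Fin D, δ := Finset.sum_le_sum fun j _ => hu _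
      _ = D * δ := by simp
  -- hence the combination vanishes
  have hzero : Ψ c = 0 := by
    refine MvPolynomial.ext _ _ fun s => ?_
    rw [MvPolynomial.coeff_zero]
    by_cases hs : s ∈ S'
    · have := congrFun hΦ ⟨s, hs⟩
      simpa [Φ] using this
    · rw [← MvPolynomial.notMem_support_iff]
      intro hmem
      apply hs
      rw [hS', Finset.mem_biUnion]
      refine ⟨s.sum fun _ x => x, Finset.mem_range.mpr ?_,
        Finset.mem_finsuppAntidiag'.mpr ⟨rfl, Finset.subset_univ _⟩⟩
      have := (MvPolynomial.le_totalDegree hmem).trans hdeg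
      omega
  rw [← hΨ]
  exact hzero

/-! ## 2. The equation built from a coefficient vector on block-products of variables -/

/-- Evaluation of a combination of block-products of variables. [folklore] -/
theorem eval_blockPoly {T : Type*} {D K : ℕ} (t : Fin D × Fin K → T) (c : (Fin D → Fin K) → ℂ)
    (x : T → ℂ) :
    eval x (∑ g, c g • ∏ j, (X (t (j, g j)) : MvPolynomial T ℂ)) = ∑ g, c g * ∏ j, x (t (j, g j)) := by
  simp [map_sum, map_prod, smul_eval]

/-- Evaluation of the corresponding combination of block-products of polynomials. [folklore] -/
theorem eval_blockComb {L T : Type*} {D K : ℕ} (u : T → MvPolynomial L ℂ) (t : Fin D × Fin K → T)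
    (c : (Fin D → Fin K) → ℂ) (y : L → ℂ) :
    eval y (∑ g, c g • ∏ j, u (t (j, g j))) = ∑ g, c g * ∏ j, eval y (u (t (j, g j))) := by
  simp [map_sum, map_prod, smul_eval]

/-- A block-product of variables is the monomial of the sum of the corresponding unit exponents.
[folklore] -/
theorem prod_X_eq_monomial {T : Type*} {D K : ℕ} (t : Fin D × Fin K → T) (g : Fin D → Fin K) :
    (∏ j, (X (t (j, g j)) : MvPolynomial T ℂ)) =
      monomial (∑ j, Finsupp.single (t (j, g j)) 1) 1 := by
  rw [MvPolynomial.monomial_sum_one]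
  rfl

/-- Distinct block choices give distinct exponents when the block family is injective. [folklore] -/
theorem blockExp_injective {T : Type*} [DecidableEq T] {D K : ℕ} {t : Fin D × Fin K → T}
    (ht : Function.Injective t) :
    Function.Injective (fun g : Fin D → Fin K => ∑ j, Finsupp.single (t (j, g j)) (1 : ℕ)) := by
  intro g g' h
  funext j
  have h1 := congrArg (fun e : T →₀ ℕ => e (t (j, g j))) h
  simp only [Finsupp.coe_finsetSum, Finset.sum_apply, Finsupp.single_apply] at h1
  have hl : (∑ j' : Fin D, if t (j', g j') = t (j, g j) then (1 : ℕ) else 0) = 1 := by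
    rw [Finset.sum_eq_single j]
    · rw [if_pos rfl]
    · intro j' _ hj'
      rw [if_neg]
      intro heq
      exact hj' (congrArg Prod.fst (ht heq))
    · intro hj
      exact absurd (Finset.mem_univ j) hj
  have hr : (∑ j' : Fin D, if t (j', g' j') = t (j, g j) then (1 : ℕ) else 0) =
      if g' j = g j then 1 else 0 := by
    rw [Finset.sum_eq_single j]
    · by_cases hgj : g' j = g j
      · rw [hgj, if_pos rfl, if_pos rfl]
      · rw [if_neg, if_neg hgj]
        intro heq
        exact hgj (by simpa using congrArg Prod.snd (ht heq))
    · intro j' _ hj'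
      rw [if_neg]
      intro heq
      exact hj' (congrArg Prod.fst (ht heq))
    · intro hj
      exact absurd (Finset.mem_univ j) hj
  rw [hl, hr] at h1
  by_contra hne
  rw [if_neg (fun h => hne h.symm)] at h1
  exact one_ne_zero h1

/-- A combination of block-products of variables with a nonzero coefficient vector is a nonzero
polynomial (injective block family). [folklore] -/
theorem blockPoly_ne_zero {T : Type*} [DecidableEq T] {D K : ℕ} {t : Fin D × Fin K → T}
    (ht : Function.Injective t) {c : (Fin D → Fin K) → ℂ} (hc : c ≠ 0) :
    (∑ g, c g • ∏ j, (X (t (j, g j)) : MvPolynomial T ℂ)) ≠ 0 := by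
  classical
  obtain ⟨g₀, hg₀⟩ := Function.ne_iff.mp hc
  intro hE
  have h := congrArg (coeff (∑ j, Finsupp.single (t (j, g₀ j)) (1 : ℕ))) hE
  rw [coeff_sum, coeff_zero] at h
  simp_rw [prod_X_eq_monomial, coeff_smul, coeff_monomial] at h
  rw [Finset.sum_eq_single g₀] at h
  · exact hg₀ (by simpa using h)
  · intro g _ hg
    rw [if_neg (fun h' => hg (blockExp_injective ht h')), smul_zero]
  · intro hg
    exact absurd (Finset.mem_univ g₀) hg

/-- Degree of a combination of block-products of `D` variables: `≤ D`. [folklore] -/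
theorem totalDegree_blockPoly_le {T : Type*} {D K : ℕ} (t : Fin D × Fin K → T)
    (c : (Fin D → Fin K) → ℂ) :
    (∑ g, c g • ∏ j, (X (t (j, g j)) : MvPolynomial T ℂ)).totalDegree ≤ D := by
  refine MvPolynomial.totalDegree_finsetSum_le fun g _ => ?_
  refine (MvPolynomial.totalDegree_smul_le _ _).trans ?_
  refine (MvPolynomial.totalDegree_finsetProd _ _).trans ?_
  calc ∑ j, (X (t (j, g j)) : MvPolynomial T ℂ).totalDegree ≤ ∑ _j : Fin D, 1 :=
        Finset.sum_le_sum fun j _ => (MvPolynomial.totalDegree_X (R := ℂ) _).le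
    _ = D := by simp

/-- Size of a combination of `K^D` block-products of `D` variables: `≤ K^D (D + 2)` (no sharing).
[folklore] -/
theorem complexity_blockPoly_le {T : Type*} {D K : ℕ} (t : Fin D × Fin K → T)
    (c : (Fin D → Fin K) → ℂ) :
    complexity (∑ g, c g • ∏ j, (X (t (j, g j)) : MvPolynomial T ℂ)) ≤ K ^ D * (D + 2) := by
  classical
  have hprod : ∀ g : Fin D → Fin K,
      complexity (∏ j, (X (t (j, g j)) : MvPolynomial T ℂ)) ≤ D := by
    intro g
    refine (complexity_finset_prod_le _ _).trans ?_
    have h0 : ∑ j : Fin D, complexity (X (t (j, g j)) : MvPolynomial T ℂ) = 0 :=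
      Finset.sum_eq_zero fun j _ => complexity_X_holds _
    rw [h0, Finset.card_univ, Fintype.card_fin]
    omega
  have hterm : ∀ g : Fin D → Fin K,
      complexity (c g • ∏ j, (X (t (j, g j)) : MvPolynomial T ℂ)) ≤ D + 1 :=
    fun g => (complexity_smul_le_holds _ _).trans (by have := hprod g; omega)
  refine (complexity_finset_sum_le _ _).trans ?_
  have hsum : ∑ g : Fin D → Fin K, complexity (c g • ∏ j, (X (t (j, g j)) : MvPolynomial T ℂ)) ≤
      ∑ _g : Fin D → Fin K, (D + 1) := Finset.sum_le_sum fun g _ => hterm g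
  rw [Finset.sum_const, Finset.card_univ, smul_eq_mul, Fintype.card_fun, Fintype.card_fin,
    Fintype.card_fin] at hsum
  rw [Finset.card_univ, Fintype.card_fun, Fintype.card_fin, Fintype.card_fin]
  calc _ ≤ K ^ D * (D + 1) + K ^ D := by omega
    _ = K ^ D * (D + 2) := by ring

/-! ## 3. A supply of `2^(n-1)` distinct top monomials -/

/-- **Top monomials indexed by bit-vectors.**  For `w : Fin n' → Bool` the exponent with entry
`[w i = false]` at `i < n'` and the remaining degree at the last variable has degree `n' + 1` and
determines `w`: an injective family of `2^n'` top monomials in `n' + 1` variables. [folklore] -/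
theorem exists_injective_topMonomials (n' : ℕ) :
    ∃ τ : (Fin n' → Bool) → topMonomials (n' + 1), Function.Injective τ := by
  classical
  let v : (Fin n' → Bool) → Fin (n' + 1) → ℕ := fun w =>
    Fin.lastCases (1 + (Finset.univ.filter fun i' : Fin n' => w i' = true).card)
      (fun i' => if w i' then 0 else 1)
  let e : (Fin n' → Bool) → (Fin (n' + 1) →₀ ℕ) := fun w => Finsupp.equivFunOnFinite.symm (v w)
  have he : ∀ w i, e w i = v w i := fun w i => rfl
  have hdeg : ∀ w, (e w).degree = n' + 1 := by
    intro w
    rw [Finsupp.degree_eq_sum, Fin.sum_univ_castSucc]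
    simp only [he, v, Fin.lastCases_castSucc, Fin.lastCases_last]
    have hsplit : (∑ i : Fin n', if w i then 0 else 1) =
        (Finset.univ.filter fun i' : Fin n' => ¬ (w i' = true)).card := by
      rw [Finset.card_filter]
      refine Finset.sum_congr rfl fun i _ => ?_
      by_cases hw : w i = true
      · simp [hw]
      · simp [hw]
    rw [hsplit]
    have := Finset.card_filter_add_card_filter_not (s := (Finset.univ : Finset (Fin n')))
      (fun i' : Fin n' => w i' = true)
    rw [Finset.card_univ, Fintype.card_fin] at this
    omega
  refine ⟨fun w => ⟨e w, hdeg w⟩, fun w w' h => ?_⟩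
  have h' : e w = e w' := congrArg Subtype.val h
  funext i
  have hi := congrArg (fun f : Fin (n' + 1) →₀ ℕ => f (Fin.castSucc i)) h'
  simp only [he, v, Fin.lastCases_castSucc] at hi
  cases hw : w i <;> cases hw' : w' i <;> simp_all

/-- The same supply for `n ≥ 1` variables, indexed by `Fin (n - 1) → Bool`. [folklore] -/
theorem exists_injective_topMonomials' {n : ℕ} (hn : 1 ≤ n) :
    ∃ τ : (Fin (n - 1) → Bool) → topMonomials n, Function.Injective τ := by
  obtain ⟨n', rfl⟩ : ∃ n', n = n' + 1 := ⟨n - 1, by omega⟩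
  exact exists_injective_topMonomials n'

/-! ## 4. Arithmetic: the parameters are eventually fine -/

/-- Raz's label count is polynomial: `3 (2n + 4 n^b (n+1)² + 1)^5 ≤ n^(5b + 21)` for `n ≥ 3`.
[folklore] -/
theorem labelBound_le_pow {n : ℕ} (b : ℕ) (hn : 3 ≤ n) :
    3 * (n + n + 4 * n ^ b * (n + 1) ^ 2 + 1) ^ 5 ≤ n ^ (5 * b + 21) := by
  have hb : 1 ≤ n ^ b := Nat.one_le_pow _ _ (by omega)
  have h1 : (n + 1) ^ 2 ≤ 2 * n ^ 2 := by nlinarith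
  have h2 : 4 * n ^ b * (n + 1) ^ 2 ≤ 8 * n ^ (b + 2) := by
    calc 4 * n ^ b * (n + 1) ^ 2 ≤ 4 * n ^ b * (2 * n ^ 2) := Nat.mul_le_mul_left _ h1
      _ = 8 * n ^ (b + 2) := by ring
  have h3 : n + n + 1 ≤ n ^ (b + 2) := by
    have : n ^ 2 ≤ n ^ (b + 2) := Nat.pow_le_pow_right (by omega) (by omega)
    nlinarith
  have h4 : n + n + 4 * n ^ b * (n + 1) ^ 2 + 1 ≤ 9 * n ^ (b + 2) := by omega
  have h5 : 9 * n ^ (b + 2) ≤ n ^ (b + 4) := by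
    have h9 : 9 ≤ n ^ 2 := by nlinarith
    calc 9 * n ^ (b + 2) ≤ n ^ 2 * n ^ (b + 2) := Nat.mul_le_mul_right _ h9
      _ = n ^ (b + 4) := by rw [← pow_add]; congr 1; ring
  have h6 : (n + n + 4 * n ^ b * (n + 1) ^ 2 + 1) ^ 5 ≤ (n ^ (b + 4)) ^ 5 :=
    Nat.pow_le_pow_left (h4.trans h5) 5
  have h7 : (n ^ (b + 4)) ^ 5 = n ^ (5 * b + 20) := by rw [← pow_mul]; congr 1; ring
  calc 3 * (n + n + 4 * n ^ b * (n + 1) ^ 2 + 1) ^ 5 ≤ 3 * n ^ (5 * b + 20) := by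
        rw [← h7]; exact Nat.mul_le_mul_left _ h6
    _ ≤ n * n ^ (5 * b + 20) := Nat.mul_le_mul_right _ (by omega)
    _ = n ^ (5 * b + 21) := by rw [← pow_succ']

/-- **The eventual inequalities.**  With `c₀ = 5b + 21` (so that `m ≤ n^c₀` bounds Raz's label
count), eventually in `n`: `n ≥ 3`, the `(n^c₀ + 1)(2n(n^c₀+1) + 2)` top monomials needed are
available (`≤ 2^(n-1)`), and `(n + 1)(n^c₀ + 1) + 1 ≤ n^(c₀ + 3)` (size exponent). [folklore] -/
theorem eventually_params (b : ℕ) :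
    ∃ n₀ : ℕ, ∀ n, n₀ ≤ n → 3 ≤ n ∧
      (n ^ (5 * b + 21) + 1) * (2 * n * (n ^ (5 * b + 21) + 1) + 2) ≤ 2 ^ (n - 1) ∧
      2 * n * (n ^ (5 * b + 21) + 1) + 2 ≤ 2 ^ n ∧
      (n + 1) * (n ^ (5 * b + 21) + 1) + 1 ≤ n ^ (5 * b + 24) := by
  set c₀ := 5 * b + 21 with hc₀
  obtain ⟨n₁, hn₁⟩ := Literature.Algebra.EuclideanLattices.Regev2004.exists_mul_pow_le_two_pow 32 (2 * c₀ + 1)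
  refine ⟨max n₁ 3, fun n hn => ?_⟩
  have h3 : 3 ≤ n := le_trans (le_max_right _ _) hn
  have hn₁' : 32 * n ^ (2 * c₀ + 1) ≤ 2 ^ n := hn₁ n (le_trans (le_max_left _ _) hn)
  have hp : 1 ≤ n ^ c₀ := Nat.one_le_pow _ _ (by omega)
  have hpn : n ≤ n ^ c₀ := by
    calc n = n ^ 1 := (pow_one n).symm
      _ ≤ n ^ c₀ := Nat.pow_le_pow_right (by omega) (by omega)
  -- `(n^c₀ + 1)(2n(n^c₀+1)+2) ≤ 16 n^(2c₀+1)`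
  have hA : (n ^ c₀ + 1) * (2 * n * (n ^ c₀ + 1) + 2) ≤ 16 * n ^ (2 * c₀ + 1) := by
    have e1 : n ^ (2 * c₀ + 1) = n * (n ^ c₀ * n ^ c₀) := by
      rw [show 2 * c₀ + 1 = c₀ + c₀ + 1 by ring, pow_succ, pow_add]; ring
    rw [e1]
    have : n ^ c₀ + 1 ≤ 2 * n ^ c₀ := by omega
    have : 2 * n * (n ^ c₀ + 1) + 2 ≤ 8 * n * n ^ c₀ := by nlinarith
    calc (n ^ c₀ + 1) * (2 * n * (n ^ c₀ + 1) + 2) ≤ (2 * n ^ c₀) * (8 * n * n ^ c₀) :=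
          Nat.mul_le_mul ‹_› ‹_›
      _ = 16 * (n * (n ^ c₀ * n ^ c₀)) := by ring
      _ ≤ 16 * (n * (n ^ c₀ * n ^ c₀)) := le_rfl
  refine ⟨h3, ?_, ?_, ?_⟩
  · -- `16 n^(2c₀+1) ≤ 2^(n-1)` from `32 n^(2c₀+1) ≤ 2^n`
    have h2 : 2 ^ n = 2 * 2 ^ (n - 1) := by
      rw [← pow_succ']; congr 1; omega
    rw [h2] at hn₁'
    refine hA.trans ?_
    omega
  · -- `2n(n^c₀+1)+2 ≤ 8 n^(c₀+1) ≤ 32 n^(2c₀+1) ≤ 2^n`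
    have : 2 * n * (n ^ c₀ + 1) + 2 ≤ 8 * n ^ (2 * c₀ + 1) := by
      have e1 : n ^ (2 * c₀ + 1) = n * (n ^ c₀ * n ^ c₀) := by
        rw [show 2 * c₀ + 1 = c₀ + c₀ + 1 by ring, pow_succ, pow_add]; ring
      rw [e1]
      have : n * n ^ c₀ ≤ n * (n ^ c₀ * n ^ c₀) := Nat.mul_le_mul_left _ (by nlinarith)
      nlinarith
    omega
  · -- `(n+1)(n^c₀+1)+1 ≤ 4 n^(c₀+1) + … ≤ n^(c₀+3)`
    have e2 : n ^ (5 * b + 24) = n ^ 3 * n ^ c₀ := by rw [hc₀, ← pow_add]; congr 1; ring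
    rw [e2]
    have h27 : 27 ≤ n ^ 3 := by
      calc 27 = 3 ^ 3 := by norm_num
        _ ≤ n ^ 3 := Nat.pow_le_pow_left h3 3
    have : (n + 1) * (n ^ c₀ + 1) + 1 ≤ 4 * n * n ^ c₀ + 1 := by nlinarith
    have : 4 * n * n ^ c₀ + 1 ≤ n ^ 3 * n ^ c₀ := by
      have h9 : 9 * n ≤ n ^ 3 := by
        calc 9 * n ≤ n ^ 2 * n := Nat.mul_le_mul_right _ (by nlinarith)
          _ = n ^ 3 := by ring
      have : 4 * n + 1 ≤ n ^ 3 := by omega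
      nlinarith
    omega

end QuasiPoly

/-! ## Registered sub-goal (signature verbatim as registered on stmt-ValiantsHypothesis-8745) -/

/-- **Registered sub-goal** `exists_injective_topMonomials`: for `n ≥ 1` there is an injective
family of top monomials (degree exactly `n` in `n` variables) indexed by the `2^(n-1)` bit-vectors
`Fin (n - 1) → Bool` — the supply of distinct coordinates consumed by the dimension count of
`quasiPolyEquations`. [folklore] -/
theorem exists_injective_topMonomials :
    ∀ n : ℕ, 1 ≤ n → ∃ τ : (Fin (n - 1) → Bool) → ↥(Summit.ValiantsHypothesis.ValiantsHypothesis.Theorems.BarrierLeverDefinableEquations.topMonomials n), Function.Injective τ :=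
  fun _ hn => QuasiPoly.exists_injective_topMonomials' hn

end Summit.ValiantsHypothesis.ValiantsHypothesis.Theorems.BarrierLeverDefinableEquations

end
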